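import Summits.CriticalPhenomena.CardyFormulaZ2.Theorems.CardyComplexConeEdgePrecompactUFRSRectMono

/-!
# One strand-crossing away from the marked edges decays polynomially (ONE)
(line `qkz-strip-boundary-arm` of crux `CardyComplexCone.EdgePrecompact`, stmt-CriticalPhenomena-11387;
registered single-scale decay `ufrs_rect_oneStrandDecay` (ONE) of the UFRS programme on rectangles,
the third input of the landed reduction `ufrs_rectBoundaryStrandDecay_of_bridges : HT → HJ → ONE → BSD`)

**Theorem** (`ufrs_rect_oneStrandDecay`). For an axis-parallel rectangle `D` there are `C, α > 0`
and `η₀ > 0` such that for `0 < η < η₀`, every fine `ℤ²`-admissible datum `E` of `D`, every shift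
`w` with `‖E.δ w‖ < η`, every `z ∈ D`, `η ≤ s`, `0 < S`, if all marked (`A`–`B`) edges of `E` and of
`shiftData E w` have their midpoints at distance `≥ 2S` from `z`, then
`P_{1/2}(ufrsStrands E w z 1 s S) ≤ C (s/S)^α`.

Proof (assembly of landed pieces).
* Scales (as in `ufrs_rect_flatThreeStrandDecay_of_hpArms`): with `c₀` an eighth of the short side,
  `L = width + height + 1`, `Λ = max 1 (L/c₀)`, `M = 32Λ`: for `S ≤ M s` the bound is trivial
  (`P ≤ 1 ≤ (M s/S)^α`); for `S ≥ L` the event is empty (`ufrsStrands_rect_eq_empty`: the far end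
  of a strand is a point of `D` or of `D + E.δ w`); otherwise shrink the outer radius to
  `b = S' - 2δ`, `S' = min S c₀ ≥ S/Λ` (`ufrsStrands_mono_radii`).
* Monochromatic band: no marked edge of `E` is within `2S' ≤ 2S` of `z` and `8S' ≤` short side, so
  by `ufrs_rect_boundaryMonochromatic` (Part B, `…UFRSRectMono.lean`) no site of `E.zdArcA`, or no
  site of `E.zdArcB`, is within `S' = b + 2δ` of `z`; the same for the translate `shiftData E w`, an
  admissible datum (`isZdAdmissible_shiftData`) of the translated rectangle (`vadd_rect_ONE`) with
  the same mesh and its marked edges also far from `z`.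
* Genuine arm and RSW: `real_ufrsStrands_one_le_of_mono` (`…UFRSOneStrandGenuine.lean`) bounds the
  one-strand probability by `P(open crossing of A(z; s, b)) + P(dual crossing of A(z; s+2δ, b-2δ))`
  and `real_open_add_dual_le` (RSW one-arm bounds `annulusOpenCrossing_half_le_holds`,
  `annulusDualCrossing_half_le_holds`) by `2 (4s/b)^{min α_o α_d} ≤ 2 M^α (s/S)^α`.

References: S. Smirnov, C. R. Acad. Sci. Paris 333 (2001), §2; G. Grimmett, *Percolation* (1999),
§11.8 (one-arm bound); G. F. Lawler, O. Schramm, W. Werner, Electron. J. Probab. 7 (2002), App. A.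
-/

set_option linter.unusedVariables false

namespace Summit.CriticalPhenomena.CardyFormulaZ2.Cruxes.EdgePrecompact.QkzStripBoundaryArm

open MeasureTheory Filter Set Metric
open scoped Topology BigOperators Pointwise
open Literature.Probability.LatticeModels Literature.Probability.Percolation
open Literature.Probability.RandomPlanarGeometry (DobrushinDomain)
open Summit.CriticalPhenomena.CardyFormulaZ2.Theses.CardyComplexCone

noncomputable section

/-! ## The translated rectangle and the monochromatic band -/

/-- A translate of an open axis-parallel rectangle is an open axis-parallel rectangle. -/
theorem vadd_rect_ONE (u : ℂ) (x₀ x₁ y₀ y₁ : ℝ) :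
    u +ᵥ (Set.Ioo x₀ x₁ ×ℂ Set.Ioo y₀ y₁) =
      Set.Ioo (u.re + x₀) (u.re + x₁) ×ℂ Set.Ioo (u.im + y₀) (u.im + y₁) := by
  ext p
  simp only [Set.mem_vadd_set, Complex.mem_reProdIm, Set.mem_Ioo, vadd_eq_add]
  constructor
  · rintro ⟨q, ⟨⟨h1, h2⟩, h3, h4⟩, rfl⟩
    simp only [Complex.add_re, Complex.add_im]
    exact ⟨⟨by linarith, by linarith⟩, by linarith, by linarith⟩
  · rintro ⟨⟨h1, h2⟩, h3, h4⟩
    refine ⟨p - u, ⟨⟨?_, ?_⟩, ?_, ?_⟩, by abel⟩ <;>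
      simp only [Complex.sub_re, Complex.sub_im] <;> linarith

/-- **The monochromatic band of one datum.** For `ℤ²`-admissible data `F` of an open rectangle, a
radius `T` with `F.δ ≤ T`, `8T ≤` short side, all marked midpoints of `F` at distance `≥ 2T` from
`z`, and `b + 2 F.δ ≤ T`: no site of `F.zdArcA`, or no site of `F.zdArcB`, has its mesh point at
distance in `(a - 2 F.δ, b + 2 F.δ)` from `z` (the hypothesis of `ufrs_strand_genuineCrossing`), by
`ufrs_rect_boundaryMonochromatic`. -/
theorem monoBand_ONE {F : DiscreteDobrushin} {x₀ x₁ y₀ y₁ : ℝ} (hx : x₀ < x₁) (hy : y₀ < y₁)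
    (hFΩ : F.Ω = Set.Ioo x₀ x₁ ×ℂ Set.Ioo y₀ y₁) (hF : F.IsZdAdmissible) {z : ℂ} {a b T : ℝ}
    (hδT : F.δ ≤ T) (h8T : 8 * T ≤ min (x₁ - x₀) (y₁ - y₀))
    (hnoAB : ∀ e₀ ∈ F.zdABEdges, 2 * T ≤ dist (medialPoint F.δ e₀) z) (hbT : b + 2 * F.δ ≤ T) :
    (∀ x ∈ F.zdArcA, dist (meshPoint F.δ x) z ≤ a - 2 * F.δ ∨ b + 2 * F.δ ≤ dist (meshPoint F.δ x) z) ∨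
      (∀ x ∈ F.zdArcB, dist (meshPoint F.δ x) z ≤ a - 2 * F.δ ∨ b + 2 * F.δ ≤ dist (meshPoint F.δ x) z) := by
  rcases ufrs_rect_boundaryMonochromatic F x₀ x₁ y₀ y₁ hx hy hFΩ hF z T hδT h8T hnoAB with h | h
  · exact Or.inl fun x hx => Or.inr (by linarith [h x hx])
  · exact Or.inr fun x hx => Or.inr (by linarith [h x hx])

/-! ## The registered statement -/

/-- **ONE: one strand-crossing away from the marked edges decays polynomially** (registered
single-scale decay `ufrs_rect_oneStrandDecay` of stmt-CriticalPhenomena-11387). For an axis-parallel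
rectangle `D` there are `C, α > 0`, `η₀ > 0` such that for `0 < η < η₀` there is `δ₀ > 0` with: for
every `ℤ²`-admissible datum `E` of `D` with `E.δ < δ₀`, every `w` with `‖E.δ w‖ < η`, every `z ∈ D`
with `infDist z Dᶜ ≤ s`, `η ≤ s`, `0 < S`, and all marked edges of `E` and of `shiftData E w` at
distance `≥ 2S` from `z`, `P_{1/2}(ufrsStrands E w z 1 s S) ≤ C (s/S)^α`. See the module docstring. -/
theorem ufrs_rect_oneStrandDecay : ∀ (D : DobrushinDomain), (∃ x₀ x₁ y₀ y₁ : ℝ, x₀ < x₁ ∧ y₀ < y₁ ∧ D.carrier = Set.Ioo x₀ x₁ ×ℂ Set.Ioo y₀ y₁) → ∃ C α : ℝ, 0 < C ∧ 0 < α ∧ ∃ η₀ > (0:ℝ), ∀ η : ℝ, 0 < η → η < η₀ → ∃ δ₀ > (0:ℝ), ∀ E : DiscreteDobrushin, E.Ω = D.carrier → E.IsZdAdmissible → E.δ < δ₀ → ∀ w : Site 2, ‖meshPoint E.δ w‖ < η → ∀ (z : ℂ) (s S : ℝ), z ∈ D.carrier → infDist z D.carrierᶜ ≤ s → η ≤ s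 → 0 < S → (∀ e₀ : Sym2 (Site 2), (e₀ ∈ E.zdABEdges ∨ e₀ ∈ (shiftData E w).zdABEdges) → 2 * S ≤ dist (medialPoint E.δ e₀) z) → (bondPercolation (zdGraph 2) half).real (ufrsStrands E w z 1 s S) ≤ C * (s / S) ^ α := by
  intro D hD
  obtain ⟨x₀, x₁, y₀, y₁, hx, hy, hcar⟩ := hD
  obtain ⟨αo, co, hαo, hco, ho⟩ := annulusOpenCrossing_half_le_holds
  obtain ⟨αd, cd, hαd, hcd, hd⟩ := annulusDualCrossing_half_le_holds
  have hα : 0 < min αo αd := lt_min hαo hαd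
  -- geometric constants
  set c₀ : ℝ := min (x₁ - x₀) (y₁ - y₀) / 8 with hc₀
  have hc₀pos : 0 < c₀ := by
    have : 0 < min (x₁ - x₀) (y₁ - y₀) := lt_min (by linarith) (by linarith)
    rw [hc₀]; positivity
  set L : ℝ := (x₁ - x₀) + (y₁ - y₀) + 1 with hL
  set Λ : ℝ := max 1 (L / c₀) with hΛ
  have hΛ1 : 1 ≤ Λ := le_max_left _ _
  have hΛpos : 0 < Λ := lt_of_lt_of_le one_pos hΛ1
  have hLΛ : L ≤ Λ * c₀ := by
    have : L / c₀ ≤ Λ := le_max_right _ _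
    rwa [div_le_iff₀ hc₀pos] at this
  have hM1 : (1 : ℝ) ≤ 32 * Λ := by linarith
  have hMα : 1 ≤ (32 * Λ) ^ min αo αd := Real.one_le_rpow hM1 hα.le
  refine ⟨2 * (32 * Λ) ^ min αo αd, min αo αd, by positivity, hα, 1, one_pos, fun η hη hη1 => ?_⟩
  refine ⟨η / (co + cd + 2), by positivity, fun E hEΩ hE hδ w hw z s S hz hzs hηs hS hmarked => ?_⟩
  set μ := bondPercolation (zdGraph 2) half with hμ
  have hs : 0 < s := lt_of_lt_of_le hη hηs
  have hδpos : 0 < E.δ := hE.delta_pos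
  have hEΩ' : E.Ω = Set.Ioo x₀ x₁ ×ℂ Set.Ioo y₀ y₁ := hEΩ.trans hcar
  have hzD : z ∈ Set.Ioo x₀ x₁ ×ℂ Set.Ioo y₀ y₁ := hcar ▸ hz
  -- mesh bookkeeping: `(co + cd + 2) δ < η ≤ s`
  have hδη : (co + cd + 2) * E.δ < η := by
    have h := (lt_div_iff₀ (by positivity : (0:ℝ) < co + cd + 2)).1 hδ
    linarith
  have hcoδ0 : 0 ≤ co * E.δ := by positivity
  have hcdδ0 : 0 ≤ cd * E.δ := by positivity
  have hcoδ : co * E.δ ≤ s := by linarith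
  have hcdδ : cd * E.δ ≤ s := by linarith
  have h2δ : 2 * E.δ < s := by linarith
  -- the trivial regime `S ≤ 32 Λ s`
  rcases le_or_gt S (32 * Λ * s) with hsmall | hbig
  · have hratio : 1 ≤ 32 * Λ * (s / S) := by
      rw [mul_div_assoc', le_div_iff₀ hS, one_mul]; exact hsmall
    calc μ.real (ufrsStrands E w z 1 s S) ≤ 1 := measureReal_le_one
      _ ≤ (32 * Λ * (s / S)) ^ min αo αd := Real.one_le_rpow hratio hα.le
      _ = (32 * Λ) ^ min αo αd * (s / S) ^ min αo αd := Real.mul_rpow (by positivity) (by positivity)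
      _ ≤ 2 * (32 * Λ) ^ min αo αd * (s / S) ^ min αo αd := by
          have : 0 ≤ (32 * Λ) ^ min αo αd * (s / S) ^ min αo αd := by positivity
          linarith
  -- the empty regime `L ≤ S`
  rcases le_or_gt L S with hfar | hSL
  · have hw1 : ‖meshPoint E.δ w‖ < 1 := lt_trans hw hη1
    rw [ufrsStrands_rect_eq_empty hEΩ' hw1 (subset_closure hzD) le_rfl (by rw [hL] at hfar; exact hfar),
      measureReal_empty]
    positivity
  -- the main regime: outer radius `b = S' - 2δ`, `S' = min S c₀`
  set S' : ℝ := min S c₀ with hS'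
  have hS'S : S' ≤ S := min_le_left _ _
  have hS'c : S' ≤ c₀ := min_le_right _ _
  have hSΛ : S ≤ Λ * S' := by
    rcases le_total S c₀ with h | h
    · rw [hS', min_eq_left h]; exact le_mul_of_one_le_left hS.le hΛ1
    · rw [hS', min_eq_right h]; linarith
  have h32 : 32 * s < S' := by
    have h : Λ * (32 * s) < Λ * S' := by nlinarith
    exact lt_of_mul_lt_mul_left h hΛpos.le
  have h8 : 8 * S' ≤ min (x₁ - x₀) (y₁ - y₀) := by rw [hc₀] at hS'c; linarith
  have hδS' : E.δ ≤ S' := by linarith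
  have hbT : S' - 2 * E.δ + 2 * E.δ ≤ S' := by linarith
  -- the monochromatic bands of `E` and of its translate
  have hmonoE := monoBand_ONE (a := s) hx hy hEΩ' hE hδS' h8
    (fun e₀ he₀ => by linarith [hmarked e₀ (Or.inl he₀)]) hbT
  set u : ℂ := meshPoint E.δ w with hu
  have hFΩ : (shiftData E w).Ω = Set.Ioo (u.re + x₀) (u.re + x₁) ×ℂ Set.Ioo (u.im + y₀) (u.im + y₁) := by
    rw [shiftData_Ω, hEΩ', vadd_rect_ONE]
  have h8' : 8 * S' ≤ min (u.re + x₁ - (u.re + x₀)) (u.im + y₁ - (u.im + y₀)) := by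
    rw [show u.re + x₁ - (u.re + x₀) = x₁ - x₀ by ring, show u.im + y₁ - (u.im + y₀) = y₁ - y₀ by ring]
    exact h8
  have hmonoE' : (∀ x ∈ (shiftData E w).zdArcA, dist (meshPoint E.δ x) z ≤ s - 2 * E.δ ∨
        S' - 2 * E.δ + 2 * E.δ ≤ dist (meshPoint E.δ x) z) ∨
      (∀ x ∈ (shiftData E w).zdArcB, dist (meshPoint E.δ x) z ≤ s - 2 * E.δ ∨
        S' - 2 * E.δ + 2 * E.δ ≤ dist (meshPoint E.δ x) z) :=
    monoBand_ONE (F := shiftData E w) (a := s) (by linarith) (by linarith) hFΩ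
      (isZdAdmissible_shiftData E w hE) hδS' h8'
      (fun e₀ he₀ => le_trans (by linarith) (hmarked e₀ (Or.inr he₀))) hbT
  -- genuine arm + RSW
  have hab : s + 4 * E.δ < S' - 2 * E.δ := by linarith
  have h1 := real_ufrsStrands_one_le_of_mono hE w hab hmonoE hmonoE'
  have h2 := real_open_add_dual_le (z := z) ho hd hαo hαd hδpos hcoδ hcdδ h2δ.le
    (show 16 * s ≤ S' - 2 * E.δ by linarith)
  have hmono : ufrsStrands E w z 1 s S ⊆ ufrsStrands E w z 1 s (S' - 2 * E.δ) :=
    ufrsStrands_mono_radii le_rfl (by linarith)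
  have hbpos : 0 < S' - 2 * E.δ := by linarith
  have hratio : 4 * (s / (S' - 2 * E.δ)) ≤ 32 * Λ * (s / S) := by
    rw [mul_div_assoc', mul_div_assoc', div_le_div_iff₀ hbpos hS]
    have hΛs : 0 ≤ Λ * s := by positivity
    have hk : 0 ≤ Λ * s * (28 * S' - 64 * E.δ) := mul_nonneg hΛs (by linarith)
    calc 4 * s * S ≤ 4 * s * (Λ * S') := by gcongr
      _ ≤ 32 * Λ * s * (S' - 2 * E.δ) := by nlinarith [hk]
  calc μ.real (ufrsStrands E w z 1 s S) ≤ μ.real (ufrsStrands E w z 1 s (S' - 2 * E.δ)) :=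
        measureReal_mono hmono (measure_ne_top _ _)
    _ ≤ 2 * (4 * (s / (S' - 2 * E.δ))) ^ min αo αd := h1.trans h2
    _ ≤ 2 * (32 * Λ * (s / S)) ^ min αo αd := by
        have := Real.rpow_le_rpow (by positivity) hratio hα.le
        linarith
    _ = 2 * (32 * Λ) ^ min αo αd * (s / S) ^ min αo αd := by
        rw [Real.mul_rpow (by positivity) (by positivity)]; ring

end

end Summit.CriticalPhenomena.CardyFormulaZ2.Cruxes.EdgePrecompact.QkzStripBoundaryArm
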